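import Mathlib
import Summits.Ventures.HodgeRepro.LitRank
import Summits.Ventures.HodgeRepro.LitRankRestrict
import Summits.Ventures.HodgeRepro.LitRankYanai

/-!
# LitRankRibet — Ribet's bound: a simple CM-type of dimension `d` has rank `≥ p + 1` for every odd prime `p ∣ d`

Blind cell `pub-hodge-repro`, seat lit-2 (gen 3).  Companion of `LitRank.lean` (same seat); uses
`LitRankRestrict` (rank through right translates, `indFun`) and `LitRankYanai` (the quotient by
`normalCore H`).  Mathlib only — no character formula is needed.

**Source.** B. Dodson, *On the Mumford–Tate group of an abelian variety with complex
multiplication*, J. Algebra 111 (1987) 49–73 (store `paper:doi-10-1016-0021-8693-87-90242-0`),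
Theorem 1.4 (Ribet), p.51 (store p0003:L42–46): "Let p be an odd prime dividing n.  Then
B(n) ≥ p + 1.  In particular, the log₂-bound on B(n) is not sharp whenever n has a sufficiently
large prime factor."  (B(n) = min rank of a primitive type of dimension n, p.49.)  Dodson reproduces
Ribet's proof "for completeness, since the same arguments are required for Theorem 1.12"
(p0003:L47–49); proof printed p.51–52 (store p0003:L50–p0004:L23).  Typed in `LitRank.lean` as
the named fact `Dodson1987_theorem1_4_Ribet`; discharged here (`Dodson1987_theorem1_4_Ribet_holds`).

**Architecture (Dodson p.51–52), mirrored lemma by lemma.**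
1. Faithfulness (p0003:L50–p0004:L4): "when Φ is a primitive type on K, no element of Gal(K^c/Q)
   fixes every element of the Gal(K^c/Q)-orbit of Φ" — `exists_image_mul_ne_of_core` (for a simple
   triple with trivial normal core of `H`, no `g ≠ 1` has `S̃ x g = S̃ x` for all `x`); abstract
   triples need not be faithful, so `Dodson1987_theorem1_4_Ribet_holds` first passes to
   `quotientTriple (normalCore H)` (`LitRankYanai`: rank, dimension, simplicity unchanged).
2. Cauchy (p0004:L5–6): "there is an element g of order p in Gal(K^c/Q)" —
   `exists_prime_orderOf_dvd_card` with `p ∣ d ∣ |G|`.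
3. "V the Q-linear space spanned by the orbit of Φ" with the action of `⟨g⟩` (p0004:L6–8): `V`,
   the right-translation operator `rt g` (`𝟙_{S̃ x} ↦ 𝟙_{S̃ x g}`), `rt_mem_V`.
4. "R = Q[X]/(X^p − 1) ≅ Q ⊕ Q(ζ_p) … V = V₀ ⊕ V₁, g trivial on V₀, nontrivial on V₁, dim V₁ =
   b(p − 1), b ≥ 1" (p0004:L8–12): made elementary — `w = v − g v ≠ 0` (by 1.) is killed by
   `Φ_p(g) = N_g = Σ_{k<p} g^k` (`normOp`, `normOp_eq_aeval_cyclotomic`), and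
   `w, g w, …, g^{p−2} w` are linearly independent because `Φ_p` is irreducible of degree `p − 1`
   (Bezout in `Q[X]`, `linearIndependent_pow_apply_of_cyclotomic`); fixed vectors `u` satisfy
   `N_g u = p u` (`normOp_apply_of_fixed`), so `V₀ ∩ ker N_g = 0`.
5. "N_g Φ = Φ + Φ^g + ⋯ + Φ^{g^{p−1}} and Φ + Φ̄ both belong to V₀ and are linearly independent …
   c(2n) = pn, so c = p/2 is not an integer for p odd" (p0004:L13–21): `linearIndependent_normOp_one`
   (`Φ + Φ̄ = 𝟙_G`, `one_mem_V`; the coefficient sum `sum_normOp_indFun`).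
6. "Rank(Φ) = dim V = dim V₀ + b(p − 1) ≥ 2 + (p − 1) = p + 1" (p0004:L22–23):
   `add_one_le_rank_of_core` via `Submodule.finrank_sup_add_finrank_inf_eq`.

Corollary: Yanai's theorem (`Yanai1985_theorem_prime_nondegenerate`) follows a second time, without
Kubota's character formula (`Yanai1985_theorem_prime_nondegenerate_of_Ribet`): for `d = p` odd
`p + 1 ≤ rank ≤ d + 1`, and `d = 2` is `3 ≤ rank ≤ 3`.

No new named fact is introduced (D-0026); every intermediate result is proved inline.

SPLIT NOTE (gen 4): this is part 1 of 2 of the former single file `LitRankRibet.lean` (split at the ≤ 400-line rule; text of every declaration unchanged); the later parts are `LitRankRibet`.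
-/

open Finset Polynomial
open scoped Pointwise

namespace HodgeRepro.Lit2

/-! ## §3  The right-translation operator, `V`, and the norm operator `N_g` -/

namespace CMTriple

/-! ### The right-translation operator on functions `G → ℚ` and the span `V` of the conjugates -/

section RightTranslation

variable {G : Type*} [Group G] [Fintype G] [DecidableEq G] (T : CMTriple G)

/-- Right translation by `g` on functions: `(rt g f) y = f (y g⁻¹)`; it sends `𝟙_{S̃ x}` to
`𝟙_{S̃ x g}` (Dodson's action of `Gal` on the orbit of `Φ`). -/
noncomputable def rt (g : G) : (G → ℚ) →ₗ[ℚ] (G → ℚ) :=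
  LinearMap.funLeft ℚ ℚ (fun y : G => y * g⁻¹)

omit [Fintype G] [DecidableEq G] in
/-- `(rt g f) y = f (y g⁻¹)`. -/
theorem rt_apply (g : G) (f : G → ℚ) (y : G) : rt g f y = f (y * g⁻¹) := rfl

omit [Fintype G] [DecidableEq G] in
/-- `rt 1 = id`. -/
theorem rt_one : rt (1 : G) = LinearMap.id := by
  ext f y
  simp [rt_apply]

omit [Fintype G] [DecidableEq G] in
/-- `rt g ∘ rt h = rt (h g)`. -/
theorem rt_comp (g h : G) : rt g ∘ₗ rt h = rt (h * g) := by
  ext f y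
  simp [rt_apply, mul_assoc]

omit [Fintype G] [DecidableEq G] in
/-- `(rt g)^k = rt (g^k)`. -/
theorem rt_pow (g : G) (k : ℕ) : (rt g) ^ k = rt (g ^ k) := by
  induction k with
  | zero => rw [pow_zero, pow_zero, rt_one]; rfl
  | succ n ih => rw [pow_succ, ih, Module.End.mul_eq_comp, rt_comp, ← pow_succ']

omit [Fintype G] in
/-- `rt g 𝟙_{S̃ x} = 𝟙_{S̃ (x g)}`. -/
theorem rt_indFun_image (g x : G) :
    rt g (indFun (T.S.image (· * x))) = indFun (T.S.image (· * (x * g))) := by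
  ext y
  simp only [rt_apply, indFun]
  congr 1
  rw [T.mem_image_mul_right_iff, T.mem_image_mul_right_iff, _root_.mul_inv_rev, mul_assoc]

/-- `V = span {𝟙_{S̃ x} : x ∈ G}`, so that `rank = dim V` (`rank_eq_finrank_span_rightTranslates`). -/
noncomputable def V : Submodule ℚ (G → ℚ) :=
  Submodule.span ℚ (Set.range fun x : G => indFun (T.S.image (· * x)))

/-- Kubota's rank is the dimension of `V`. -/
theorem rank_eq_finrank_V : T.rank = Module.finrank ℚ T.V :=
  T.rank_eq_finrank_span_rightTranslates

omit [Fintype G] in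
/-- Every conjugate `𝟙_{S̃ x}` lies in `V`. -/
theorem indFun_image_mem_V (x : G) : indFun (T.S.image (· * x)) ∈ T.V :=
  Submodule.subset_span ⟨x, rfl⟩

omit [Fintype G] in
/-- `V` is stable under every right translation. -/
theorem rt_mem_V (g : G) {f : G → ℚ} (hf : f ∈ T.V) : rt g f ∈ T.V := by
  have hle : T.V ≤ T.V.comap (rt g) := by
    unfold V
    rw [Submodule.span_le]
    rintro _ ⟨x, rfl⟩
    rw [SetLike.mem_coe, Submodule.mem_comap, T.rt_indFun_image]
    exact T.indFun_image_mem_V _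
  exact hle hf

/-- The constant function `1 = 𝟙_{S̃} + 𝟙_{S̃ ρ}` lies in `V`. -/
theorem one_mem_V : (fun _ : G => (1 : ℚ)) ∈ T.V := by
  have h1 : T.S.image (· * (1 : G)) = T.S := by simp
  have h : (fun _ : G => (1 : ℚ)) = indFun (T.S.image (· * 1)) + indFun (T.S.image (· * T.ρ)) := by
    ext y
    simp only [Pi.add_apply, indFun, T.image_mul_ρ, h1]
    by_cases hy : y ∈ T.S <;> simp [hy]
  rw [h]
  exact T.V.add_mem (T.indFun_image_mem_V 1) (T.indFun_image_mem_V T.ρ)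

end RightTranslation

/-! ### The norm operator `N = Σ_{k<p} rt (g^k)` of a cyclic subgroup `⟨g⟩` of order `p` -/

section NormOp

variable {G : Type*} [Group G] (g : G) (p : ℕ)

/-- `N_g = Σ_{k < p} rt (g ^ k)` (an endomorphism of `G → ℚ`; composition is multiplication). -/
noncomputable def normOp : Module.End ℚ (G → ℚ) := ∑ k ∈ range p, rt (g ^ k)

/-- `(N_g f) y = Σ_{k<p} f (y (g^k)⁻¹)`. -/
theorem normOp_apply (f : G → ℚ) (y : G) : normOp g p f y = ∑ k ∈ range p, f (y * (g ^ k)⁻¹) := by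
  simp [normOp, LinearMap.sum_apply, rt_apply]

/-- `rt g ∘ N = N` when `g ^ p = 1`. -/
theorem rt_mul_normOp (hg : g ^ p = 1) : rt g * normOp g p = normOp g p := by
  unfold normOp
  rw [Finset.mul_sum]
  simp only [Module.End.mul_eq_comp, rt_comp]
  have h : ∀ k, g ^ k * g = g ^ (k + 1) := fun k => (pow_succ g k).symm
  simp only [h]
  have e : ∑ x ∈ range p, rt (g ^ (x + 1)) + rt (g ^ 0) = ∑ x ∈ range p, rt (g ^ x) + rt (g ^ p) :=
    (Finset.sum_range_succ' (fun x => rt (g ^ x)) p).symm.trans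
      (Finset.sum_range_succ (fun x => rt (g ^ x)) p)
  rw [hg, pow_zero] at e
  exact add_right_cancel e

/-- `N ∘ rt g = N` when `g ^ p = 1`. -/
theorem normOp_mul_rt (hg : g ^ p = 1) : normOp g p * rt g = normOp g p := by
  unfold normOp
  rw [Finset.sum_mul]
  simp only [Module.End.mul_eq_comp, rt_comp]
  have h : ∀ k, g * g ^ k = g ^ (k + 1) := fun k => (pow_succ' g k).symm
  simp only [h]
  have e : ∑ x ∈ range p, rt (g ^ (x + 1)) + rt (g ^ 0) = ∑ x ∈ range p, rt (g ^ x) + rt (g ^ p) :=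
    (Finset.sum_range_succ' (fun x => rt (g ^ x)) p).symm.trans
      (Finset.sum_range_succ (fun x => rt (g ^ x)) p)
  rw [hg, pow_zero] at e
  exact add_right_cancel e

/-- `N ∘ rt (g ^ k) = N`. -/
theorem normOp_mul_rt_pow (hg : g ^ p = 1) (k : ℕ) : normOp g p * rt (g ^ k) = normOp g p := by
  induction k with
  | zero => rw [pow_zero, rt_one]; rfl
  | succ n ih => rw [← rt_pow, pow_succ, rt_pow, ← mul_assoc, ih, normOp_mul_rt g p hg]

/-- `N` of a fixed vector is `p` times the vector. -/
theorem normOp_apply_of_fixed {u : G → ℚ} (hu : rt g u = u) : normOp g p u = (p : ℚ) • u := by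
  have hk : ∀ k : ℕ, rt (g ^ k) u = u := by
    intro k
    induction k with
    | zero => rw [pow_zero, rt_one]; rfl
    | succ n ih => rw [← rt_pow, pow_succ, Module.End.mul_apply, rt_pow, hu, ih]
  unfold normOp
  rw [LinearMap.sum_apply]
  simp only [hk, Finset.sum_const, Finset.card_range]
  exact (Nat.cast_smul_eq_nsmul ℚ p u).symm

end NormOp

end CMTriple

/-! ## §4  Bezout: `p − 1` independent vectors from one vector killed by `Φ_p(φ)` -/

/-! ### Ribet's `(p − 1)`-dimensional piece: a vector killed by `Φ_p(φ)` generates `p − 1` independent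
vectors under `φ` (the `ℚ(ζ_p)`-part of Dodson's decomposition `V = V₀ ⊕ V₁`, made elementary by
Bezout in `ℚ[X]`: `Φ_p` is irreducible of degree `p − 1`). -/

/-- If `Φ_p(φ) w = 0` and `w ≠ 0`, then `w, φ w, …, φ^{p−2} w` are linearly independent. -/
theorem linearIndependent_pow_apply_of_cyclotomic {M : Type*} [AddCommGroup M] [Module ℚ M]
    (φ : Module.End ℚ M) (p : ℕ) [hp : Fact p.Prime] {w : M} (hw : w ≠ 0)
    (hN : aeval φ (cyclotomic p ℚ) w = 0) :
    LinearIndependent ℚ (fun k : Fin (p - 1) => (φ ^ (k : ℕ)) w) := by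
  rw [Fintype.linearIndependent_iff]
  intro a ha
  by_contra hak
  obtain ⟨k, hk⟩ := not_forall.mp hak
  set c : ℚ[X] := ∑ j : Fin (p - 1), C (a j) * X ^ (j : ℕ) with hc
  -- `c(φ) w = Σ a_j φ^j w = 0`
  have hcw : aeval φ c w = 0 := by
    rw [hc, map_sum, LinearMap.sum_apply]
    rw [← ha]
    refine Finset.sum_congr rfl fun j _ => ?_
    rw [map_mul, aeval_C, aeval_X_pow, Module.End.mul_apply, Module.algebraMap_end_apply]
  -- `c ≠ 0` since its `k`-th coefficient is `a k ≠ 0`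
  have hcoeff : c.coeff (k : ℕ) = a k := by
    rw [hc, finsetSum_coeff]
    simp only [coeff_C_mul_X_pow]
    rw [Finset.sum_eq_single k]
    · simp
    · intro j _ hjk
      rw [if_neg]
      intro h
      exact hjk (Fin.ext h.symm)
    · intro h; exact absurd (Finset.mem_univ k) h
  have hc0 : c ≠ 0 := fun h => hk (by rw [← hcoeff, h, coeff_zero])
  -- `deg c ≤ p − 2 < p − 1 = deg Φ_p`, so `Φ_p ∤ c`, so they are coprime
  have hp2 : 2 ≤ p := hp.out.two_le
  have hdeg : c.natDegree ≤ p - 2 := by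
    rw [hc]
    refine natDegree_sum_le_of_forall_le _ _ fun j _ => ?_
    refine (natDegree_C_mul_X_pow_le _ _).trans ?_
    have := j.isLt
    omega
  have hdegΦ : (cyclotomic p ℚ).natDegree = p - 1 := by
    rw [natDegree_cyclotomic, Nat.totient_prime hp.out]
  have hndvd : ¬ cyclotomic p ℚ ∣ c := by
    intro hdvd
    have := natDegree_le_of_dvd hdvd hc0
    omega
  have hcop : IsCoprime (cyclotomic p ℚ) c :=
    (cyclotomic.irreducible_rat hp.out.pos).coprime_iff_not_dvd.mpr hndvd
  obtain ⟨u, v, huv⟩ := hcop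
  -- Bezout: `w = u(φ) Φ_p(φ) w + v(φ) c(φ) w = 0`
  have h1 := congrArg (aeval φ) huv
  rw [map_add, map_mul, map_mul, map_one] at h1
  have h2 := congrArg (fun e : Module.End ℚ M => e w) h1
  simp only [LinearMap.add_apply, Module.End.mul_apply, Module.End.one_apply, hN, hcw, map_zero,
    add_zero] at h2
  exact hw h2.symm

end HodgeRepro.Lit2
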